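import Mathlib
import Literature.NumberTheory.LFunctions.Zhang2022.Section16Lemma162RGlue
import HarnessLib

/-!
# Zhang (2022), §16 Lemma 16.2 at the repaired normaliser (`Lemma162Rq`): the glue from the local
# Euler factors in the MAJORANT shape — exceptional small primes allowed, region `σ > 9/10`

Topic `Literature/NumberTheory/LFunctions/Zhang2022` (Landau–Siegel audit tree; verdict-neutral).
Y. Zhang, *Discrete mean estimates and the Landau–Siegel zero*, arXiv:2211.02515v1 (2022)
[Zhang2022LandauSiegel], §16 Lemma 16.2 p. 94 (tex L4646–L4653) and its Appendix-A sketch pp. 105–106,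
**an unrefereed manuscript under adjudication; nothing here asserts or denies its Theorems 1–2.**
Lane ZHANG-L, WP16 Block D (row G-d57-1), sub-leaf `Typed.Section16B.Lemma162Rq c′`.

The companion file `Section16Lemma162RGlue` proves the glue `lemma162Rq_of_local` under the local
hypothesis "`‖Φ_q(s) − 1‖ ≤ C(q^{−2σ} + q^{−1−σ})` for EVERY prime `q ∤ D`, `σ > 17/20`". That shape
cannot hold for the Euler factors actually produced for `E₂ⱼ` (`Lemma162R.hasProd_frakU2SeriesR`,
file `Section16Lemma162REuler`): the factor at `q = 2` carries the GLOBAL coefficients `ϖ₂ⱼ(2^e)`, and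
when `χ(2) = 1` one has `Φ₂(s) → ϖ₂ⱼ(1) = F₂(1,1;1−βⱼ)/2 ≈ 0` as `σ → ∞` (§16 p. 93, the
non-multiplicativity of `ϖ₂ⱼ` at `2`), so `‖Φ₂ − 1‖` does not tend to `0`. This file proves the glue in
the shape the local files deliver (`Lemma162R.exists_majorant_Phi`, `norm_Phi_sub_one_le`,
`norm_Phi_sub_one_le_crude`, `Phi_eq_of_apply_eq_zero`), all on `σ > 9/10`:

* (M) for every prime `q`: `Φ_q` holomorphic on `σ > 9/10`; for `q ∤ D` a CRUDE bound
  `‖Φ_q(s) − 1‖ ≤ K`; and for `q ≥ Q₀`, `q ∤ D`, the true size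
  `‖Φ_q(s) − 1‖ ≤ K(|q^{−s}|/q + |q^{−s}|²)`;
* (D) for `q ∣ D`: `Φ_q(s) = (1 − q^{−s})²` on `σ > 9/10`;
* (E) the `σ > 1` Euler identity `HasProd (q ↦ Φ_q(s)) (frakU2SeriesR c′ χ j s)`;
* (V) for `q ∤ D`, `q ≤ D`: `‖Φ_q(1) − m_q‖ ≤ C·α·log q/q` (`m_q` the factors of `hasProd_frakU2Main`).

THEOREMS (no definitions, no facts): `differentiableOn_tprod_of_majorant` (holomorphy of `∏'_q Φ_q`
on `σ > 9/10`, majorant `3·[q∣D] + K·[q<Q₀] + 2K q^{−9/5}`), `exists_halfPlane_bound_of_majorant`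
(`‖∏'_q Φ_q(s)‖ ≤ K′·e^{2𝓛^{1/10}}` on `σ > 9/10` — serves (iii) and (iv)),
`exists_nearOne_bound_of_majorant` (`≤ K′·𝓛` on `‖s − 1‖ ≤ 1/𝓛`, `𝓛 ≥ 20`), and
**`lemma162Rq_of_majorant`** `: Lemma162Rq c′` (value clause through
`exists_value_bound_of_local` with `C_b := K(Q₀² + 1)`). WHAT THIS IS NOT: a proof of (M), (D),
(E), (V) for the actual factors, or of anything about Theorems 1–2 / Landau–Siegel zeros.

## References

* Y. Zhang, arXiv:2211.02515v1 (2022), §16 Lemma 16.2 p. 94; App. A pp. 105–106.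
  [cite: Zhang2022LandauSiegel, §16 Lemma 16.2 p.94]
* J. B. Conway, *Functions of One Complex Variable I* (1978), VII.5. [cite: Conway1978, VII.5]
* G. H. Hardy, E. M. Wright, *An Introduction to the Theory of Numbers* (6th ed.), Thms 62, 328, 425.
  [cite: HardyWright2008, Thm 328]
-/

noncomputable section

open Complex Real Filter Topology Finset

namespace Literature.NumberTheory.LFunctions.Zhang2022.Typed.Section16B

open Literature.NumberTheory.LFunctions.Zhang2022
open Literature.NumberTheory.LFunctions.Zhang2022.Skeleton

/-! ## Real-analysis and arithmetic helpers -/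

/-- Products of reals over a sub-finset: factors `≥ 0` on `s` and `≥ 1` on `t ∖ s` give `∏_s f ≤ ∏_t f`.
[folklore] -/
private theorem prod_le_prod_of_subset_real' {ι : Type*} [DecidableEq ι] {s t : Finset ι} (f : ι → ℝ)
    (hst : s ⊆ t) (hs : ∀ i ∈ s, 0 ≤ f i) (ht : ∀ i ∈ t, i ∉ s → 1 ≤ f i) :
    ∏ i ∈ s, f i ≤ ∏ i ∈ t, f i := by
  rw [← Finset.prod_sdiff hst]
  have h1 : (1 : ℝ) ≤ ∏ i ∈ t \ s, f i := by
    rw [← Finset.prod_const_one (s := t \ s)]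
    refine Finset.prod_le_prod (fun _ _ => zero_le_one) fun i hi => ?_
    exact ht i (Finset.mem_sdiff.mp hi).1 (Finset.mem_sdiff.mp hi).2
  have h0 : 0 ≤ ∏ i ∈ s, f i := Finset.prod_nonneg hs
  exact le_mul_of_one_le_left h0 h1

/-- `∏_{i∈A}(1 + x_i) ≤ exp(Σ_{i∈A} x_i)` for `x_i ≥ 0`. [folklore] -/
private theorem prod_one_add_le_exp_sum' {ι : Type*} (A : Finset ι) (x : ι → ℝ)
    (hx : ∀ i ∈ A, 0 ≤ x i) : ∏ i ∈ A, (1 + x i) ≤ Real.exp (∑ i ∈ A, x i) := by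
  rw [Real.exp_sum]
  exact Finset.prod_le_prod (fun i hi => by linarith [hx i hi]) fun i _ => by
    linarith [Real.add_one_le_exp (x i)]

/-- `‖(1 − q^{−s})² − 1‖ ≤ 3` for `σ ≥ 0` (`|q^{−s}| ≤ 1`). [folklore] -/
private theorem norm_one_sub_cpow_sq_sub_one_le' {q : ℕ} (hq : q.Prime) {s : ℂ} (hs : 0 ≤ s.re) :
    ‖(1 - (q : ℂ) ^ (-s)) ^ 2 - 1‖ ≤ 3 := by
  have hq1 : (1 : ℝ) ≤ q := by exact_mod_cast hq.one_lt.le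
  have hX : ‖(q : ℂ) ^ (-s)‖ ≤ 1 := by
    rw [Complex.norm_natCast_cpow_of_pos hq.pos, Complex.neg_re]
    exact Real.rpow_le_one_of_one_le_of_nonpos hq1 (by linarith)
  set X : ℂ := (q : ℂ) ^ (-s) with hXdef
  have e : (1 - X) ^ 2 - 1 = X * (X - 2) := by ring
  rw [e, norm_mul]
  have h2 : ‖X - 2‖ ≤ 3 := by
    calc ‖X - 2‖ ≤ ‖X‖ + ‖(2 : ℂ)‖ := norm_sub_le _ _
      _ ≤ 1 + 2 := by
          have : ‖(2 : ℂ)‖ = 2 := by simp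
          rw [this]; linarith
      _ = 3 := by norm_num
  calc ‖X‖ * ‖X - 2‖ ≤ 1 * 3 := mul_le_mul hX h2 (norm_nonneg _) (by norm_num)
    _ = 3 := by norm_num

/-- `‖1 − q^{−s}‖ ≤ 1 + q^{−9/10}` for `Re s ≥ 9/10`. [folklore] -/
private theorem norm_one_sub_cpow_le' {q : ℕ} (hq : q.Prime) {s : ℂ} (hs : 9 / 10 ≤ s.re) :
    ‖1 - (q : ℂ) ^ (-s)‖ ≤ 1 + (q : ℝ) ^ (-(9 / 10 : ℝ)) := by
  have hq1 : (1 : ℝ) ≤ q := by exact_mod_cast hq.one_lt.le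
  calc ‖1 - (q : ℂ) ^ (-s)‖ ≤ ‖(1 : ℂ)‖ + ‖(q : ℂ) ^ (-s)‖ := norm_sub_le _ _
    _ ≤ 1 + (q : ℝ) ^ (-(9 / 10 : ℝ)) := by
        rw [norm_one, Complex.norm_natCast_cpow_of_pos hq.pos, Complex.neg_re]
        exact add_le_add le_rfl (Real.rpow_le_rpow_of_exponent_le hq1 (by linarith))

/-- On `σ > 9/10`: `|q^{−s}|/q + |q^{−s}|² ≤ 2q^{−9/5}`. [folklore] -/
private theorem tail_shape_le {q : ℕ} (hq : q.Prime) {s : ℂ} (hs : 9 / 10 < s.re) :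
    ‖(q : ℂ) ^ (-s)‖ / q + ‖(q : ℂ) ^ (-s)‖ ^ 2 ≤ 2 * (q : ℝ) ^ (-(9 / 5 : ℝ)) := by
  have hq0 : (0 : ℝ) < q := by exact_mod_cast hq.pos
  have hq1 : (1 : ℝ) ≤ q := by exact_mod_cast hq.one_lt.le
  rw [Complex.norm_natCast_cpow_of_pos hq.pos, Complex.neg_re]
  have h1 : (q : ℝ) ^ (-s.re) / q = (q : ℝ) ^ (-s.re - 1) := by
    rw [Real.rpow_sub hq0, Real.rpow_one]
  have h2 : ((q : ℝ) ^ (-s.re)) ^ 2 = (q : ℝ) ^ (-(2 * s.re)) := by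
    rw [← Real.rpow_natCast, ← Real.rpow_mul hq0.le]; congr 1; push_cast; ring
  rw [h1, h2]
  have e1 : (q : ℝ) ^ (-s.re - 1) ≤ (q : ℝ) ^ (-(9 / 5 : ℝ)) :=
    Real.rpow_le_rpow_of_exponent_le hq1 (by linarith)
  have e2 : (q : ℝ) ^ (-(2 * s.re)) ≤ (q : ℝ) ^ (-(9 / 5 : ℝ)) :=
    Real.rpow_le_rpow_of_exponent_le hq1 (by linarith)
  linarith

/-- `Σ_q q^r` over the primes is summable for `r < −1`. [folklore] -/
private theorem summable_primes_rpow' {r : ℝ} (hr : r < -1) :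
    Summable fun q : Nat.Primes => ((q : ℕ) : ℝ) ^ r :=
  (Real.summable_nat_rpow.mpr hr).comp_injective Subtype.val_injective

/-- `Σ_q q^r ≤ Σ_n n^r` (primes vs. all naturals), `r < −1`. [folklore] -/
private theorem tsum_primes_rpow_le' {r : ℝ} (hr : r < -1) :
    ∑' q : Nat.Primes, ((q : ℕ) : ℝ) ^ r ≤ ∑' n : ℕ, (n : ℝ) ^ r :=
  (summable_primes_rpow' hr).tsum_le_tsum_of_inj (fun q : Nat.Primes => (q : ℕ))
    Subtype.val_injective (fun n _ => Real.rpow_nonneg (Nat.cast_nonneg n) _) (fun _ => le_rfl)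
    (Real.summable_nat_rpow.mpr hr)

/-- The indicator of the primes `< Q₀` is summable over the primes with sum `≤ Q₀` (times `K ≥ 0`).
[folklore] -/
private theorem tsum_indicator_small_primes_le (Q₀ : ℕ) {K : ℝ} (hK : 0 ≤ K) :
    (Summable fun q : Nat.Primes => if (q : ℕ) < Q₀ then K else 0) ∧
      ∑' q : Nat.Primes, (if (q : ℕ) < Q₀ then K else 0) ≤ K * Q₀ := by
  classical
  set S₀ : Finset Nat.Primes := ((Finset.range Q₀).filter Nat.Prime).subtype Nat.Prime with hS₀def
  have hmem : ∀ q : Nat.Primes, q ∈ S₀ ↔ (q : ℕ) < Q₀ := fun q => by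
    have h0 : q ∈ S₀ ↔ (q : ℕ) ∈ (Finset.range Q₀).filter Nat.Prime := Finset.mem_subtype
    rw [h0, Finset.mem_filter, Finset.mem_range]
    exact ⟨fun h => h.1, fun h => ⟨h, q.prop⟩⟩
  have hzero : ∀ q ∉ S₀, (if (q : ℕ) < Q₀ then K else 0) = 0 := fun q hq => by
    rw [if_neg (fun h => hq ((hmem q).mpr h))]
  refine ⟨summable_of_ne_finset_zero hzero, ?_⟩
  rw [tsum_eq_sum hzero]
  have h1 : ∑ q ∈ S₀, (if (q : ℕ) < Q₀ then K else 0) = ∑ q ∈ S₀, K :=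
    Finset.sum_congr rfl fun q hq => by rw [if_pos ((hmem q).mp hq)]
  rw [h1, Finset.sum_const, nsmul_eq_mul]
  have hcard : (S₀.card : ℝ) ≤ Q₀ := by
    have h2 : S₀.card ≤ ((Finset.range Q₀).filter Nat.Prime).card := by
      rw [hS₀def]
      exact Finset.card_le_card_of_injOn (fun q => (q : ℕ)) (fun q hq => Finset.mem_subtype.mp hq)
        (fun a _ b _ h => Subtype.ext h)
    have h3 : ((Finset.range Q₀).filter Nat.Prime).card ≤ Q₀ :=
      (Finset.card_filter_le _ _).trans (by simp)
    exact_mod_cast h2.trans h3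
  calc (S₀.card : ℝ) * K ≤ Q₀ * K := by gcongr
    _ = K * Q₀ := by ring

/-- `log D ≥ L₀` once `D ≥ ⌈exp L₀⌉₊`. [folklore] -/
private theorem ell_ge_of_ge_ceil_exp' {L₀ : ℝ} {D : ℕ} (hD : ⌈Real.exp L₀⌉₊ ≤ D) : L₀ ≤ ell D := by
  have hD' : Real.exp L₀ ≤ D := le_trans (Nat.le_ceil _) (by exact_mod_cast hD)
  have hD0 : (0 : ℝ) < D := lt_of_lt_of_le (Real.exp_pos _) hD'
  rw [ell]; exact (Real.le_log_iff_exp_le hD0).mpr hD'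

/-- `α𝓛 = π/𝓛⁸ ≤ π·𝓛⁻⁴` once `𝓛 ≥ 1`. [cite: Zhang2022LandauSiegel, §2 (2.10)] -/
private theorem alpha_mul_ell_le' {D : ℕ} (hℓ : 1 ≤ ell D) :
    alpha D * ell D ≤ π * (ell D ^ 4)⁻¹ := by
  have hℓ0 : 0 < ell D := by linarith
  have hαℓ : alpha D * ell D = π / ell D ^ 8 := by
    rw [alpha, bigP, Real.log_exp]; field_simp
  rw [hαℓ, div_eq_mul_inv]
  refine mul_le_mul_of_nonneg_left ?_ Real.pi_pos.le
  refine inv_anti₀ (by positivity) ?_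
  calc ell D ^ 4 = ell D ^ 4 * 1 := (mul_one _).symm
    _ ≤ ell D ^ 4 * ell D ^ 4 := by gcongr; exact one_le_pow₀ hℓ
    _ = ell D ^ 8 := by ring

/-- **`∏_{q∣n}(1 + c/q) ≤ (n/φ(n))^c`** for a natural number `c` (`n ≥ 1`). [folklore] -/
private theorem prod_primeFactors_one_add_div_le_pow'' {n : ℕ} (hn : n ≠ 0) (c : ℕ) :
    ∏ q ∈ n.primeFactors, (1 + (c : ℝ) / q) ≤ ((n : ℝ) / Nat.totient n) ^ c := by
  have hP1 : 0 < ∏ q ∈ n.primeFactors, ((q : ℝ) - 1) :=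
    Finset.prod_pos fun q hq => by
      have : (2 : ℝ) ≤ q := by exact_mod_cast (Nat.prime_of_mem_primeFactors hq).two_le
      linarith
  have hcast : (Nat.totient n : ℝ) * ∏ q ∈ n.primeFactors, (q : ℝ) =
      (n : ℝ) * ∏ q ∈ n.primeFactors, ((q : ℝ) - 1) := by
    have h := Nat.totient_mul_prod_primeFactors n
    have h' : ((Nat.totient n * ∏ p ∈ n.primeFactors, p : ℕ) : ℝ) =
        ((n * ∏ p ∈ n.primeFactors, (p - 1) : ℕ) : ℝ) := by rw [h]
    push_cast at h'
    rw [h']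
    congr 1
    refine Finset.prod_congr rfl fun q hq => ?_
    rw [Nat.cast_sub (Nat.prime_of_mem_primeFactors hq).one_lt.le, Nat.cast_one]
  have hone : ∏ q ∈ n.primeFactors, (1 + (q : ℝ)⁻¹) ≤ (n : ℝ) / Nat.totient n := by
    have hφpos : (0 : ℝ) < Nat.totient n := by
      exact_mod_cast Nat.totient_pos.mpr (Nat.pos_of_ne_zero hn)
    rw [le_div_iff₀ hφpos]
    have h2 : ∏ q ∈ n.primeFactors, (1 + (q : ℝ)⁻¹) ≤
        ∏ q ∈ n.primeFactors, ((q : ℝ) / ((q : ℝ) - 1)) := by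
      refine Finset.prod_le_prod (fun q _ => by positivity) fun q hq => ?_
      have hq2 : (2 : ℝ) ≤ q := by exact_mod_cast (Nat.prime_of_mem_primeFactors hq).two_le
      rw [le_div_iff₀ (by linarith)]
      have hq0 : (q : ℝ) ≠ 0 := by positivity
      field_simp
      nlinarith
    have h3 : (∏ q ∈ n.primeFactors, ((q : ℝ) / ((q : ℝ) - 1))) =
        (∏ q ∈ n.primeFactors, (q : ℝ)) / ∏ q ∈ n.primeFactors, ((q : ℝ) - 1) := by
      rw [Finset.prod_div_distrib]
    calc (∏ q ∈ n.primeFactors, (1 + (q : ℝ)⁻¹)) * Nat.totient n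
        ≤ (∏ q ∈ n.primeFactors, ((q : ℝ) / ((q : ℝ) - 1))) * Nat.totient n := by gcongr
      _ = ((Nat.totient n : ℝ) * ∏ q ∈ n.primeFactors, (q : ℝ)) /
            ∏ q ∈ n.primeFactors, ((q : ℝ) - 1) := by rw [h3]; ring
      _ = (n : ℝ) := by rw [hcast, mul_div_assoc, div_self hP1.ne', mul_one]
  have h1 : ∏ q ∈ n.primeFactors, (1 + (c : ℝ) / q) ≤ ∏ q ∈ n.primeFactors, (1 + (q : ℝ)⁻¹) ^ c := by
    refine Finset.prod_le_prod (fun q _ => by positivity) fun q _ => ?_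
    have hq : (-2 : ℝ) ≤ (q : ℝ)⁻¹ := by
      have : (0 : ℝ) ≤ (q : ℝ)⁻¹ := by positivity
      linarith
    have h := one_add_mul_le_pow hq c
    rw [div_eq_mul_inv]
    exact h
  rw [Finset.prod_pow] at h1
  exact h1.trans (pow_le_pow_left₀ (Finset.prod_nonneg fun q _ => by positivity) hone c)

/-- `(2 log 𝓛)⁶ ≤ 𝓛` and `𝓛 ≥ 20` for all large `D` (`𝓛 = log D`). [folklore] -/
private theorem eventually_loglog_pow_six_le' :
    ∃ N : ℕ, ∀ D : ℕ, N ≤ D → (2 * Real.log (ell D)) ^ 6 ≤ ell D ∧ 20 ≤ ell D := by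
  have hℓ : Tendsto (fun D : ℕ => ell D) atTop atTop :=
    Real.tendsto_log_atTop.comp tendsto_natCast_atTop_atTop
  have h1 : Tendsto (fun x : ℝ => Real.log x ^ 6 / (1 * x + 0)) atTop (𝓝 0) :=
    Real.tendsto_pow_log_div_mul_add_atTop 1 0 6 one_ne_zero
  have h2 : ∀ᶠ D : ℕ in atTop, Real.log (ell D) ^ 6 / (1 * ell D + 0) ≤ 1 / 64 :=
    (h1.comp hℓ).eventually (eventually_le_nhds (by norm_num))
  have h3 : ∀ᶠ D : ℕ in atTop, 20 ≤ ell D := hℓ.eventually (eventually_ge_atTop 20)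
  obtain ⟨N, hN⟩ := Filter.eventually_atTop.mp (h2.and h3)
  refine ⟨N, fun D hD => ?_⟩
  obtain ⟨ha, hb⟩ := hN D hD
  have hℓ0 : 0 < ell D := by linarith
  rw [one_mul, add_zero, div_le_iff₀ hℓ0] at ha
  refine ⟨?_, hb⟩
  calc (2 * Real.log (ell D)) ^ 6 = 64 * Real.log (ell D) ^ 6 := by ring
    _ ≤ 64 * (1 / 64 * ell D) := by gcongr
    _ = ell D := by ring

/-! ## The cofactor bound over the primes not dividing `D` -/

/-- For a finite set of primes, the product of `‖Φ_q(s)‖` over those with `q ∤ D` is at most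
`exp(K·Q₀ + 4K·ζ(9/5))` whenever `‖Φ_q(s) − 1‖ ≤ K` (`q ∤ D`) and
`‖Φ_q(s) − 1‖ ≤ K(|q^{−s}|/q + |q^{−s}|²)` (`q ≥ Q₀`, `q ∤ D`), `σ > 9/10`. [folklore] -/
private theorem prod_filter_not_dvd_le {D Q₀ : ℕ} {K : ℝ} (hK : 0 ≤ K) (F : Nat.Primes → ℂ → ℂ)
    {s : ℂ} (hs : 9 / 10 < s.re)
    (hcrude : ∀ q : Nat.Primes, ¬ (q : ℕ) ∣ D → ‖F q s - 1‖ ≤ K)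
    (htail : ∀ q : Nat.Primes, ¬ (q : ℕ) ∣ D → Q₀ ≤ (q : ℕ) →
      ‖F q s - 1‖ ≤ K * (‖((q : ℕ) : ℂ) ^ (-s)‖ / (q : ℕ) + ‖((q : ℕ) : ℂ) ^ (-s)‖ ^ 2))
    (A : Finset Nat.Primes) :
    ∏ q ∈ A.filter (fun q : Nat.Primes => ¬ (q : ℕ) ∣ D), ‖F q s‖ ≤
      Real.exp (K * Q₀ + 2 * K * ∑' n : ℕ, (n : ℝ) ^ (-(9 / 5 : ℝ))) := by
  classical
  set Z : ℝ := ∑' n : ℕ, (n : ℝ) ^ (-(9 / 5 : ℝ)) with hZdef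
  -- the merged majorant `c_q = K·[q < Q₀] + 2K q^{−9/5}`
  set c : Nat.Primes → ℝ := fun q =>
    (if (q : ℕ) < Q₀ then K else 0) + 2 * K * ((q : ℕ) : ℝ) ^ (-(9 / 5 : ℝ)) with hcdef
  have hc0 : ∀ q, 0 ≤ c q := fun q => by
    simp only [hcdef]; split_ifs <;> positivity
  have hFc : ∀ q : Nat.Primes, ¬ (q : ℕ) ∣ D → ‖F q s - 1‖ ≤ c q := by
    intro q hqD
    have hnn : 0 ≤ 2 * K * ((q : ℕ) : ℝ) ^ (-(9 / 5 : ℝ)) := by positivity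
    by_cases hq : (q : ℕ) < Q₀
    · simp only [hcdef, if_pos hq]
      linarith [hcrude q hqD]
    · simp only [hcdef, if_neg hq, zero_add]
      have h := htail q hqD (not_lt.mp hq)
      have h2 := tail_shape_le q.prop hs
      calc ‖F q s - 1‖ ≤ K * (‖((q : ℕ) : ℂ) ^ (-s)‖ / (q : ℕ) + ‖((q : ℕ) : ℂ) ^ (-s)‖ ^ 2) := h
        _ ≤ K * (2 * ((q : ℕ) : ℝ) ^ (-(9 / 5 : ℝ))) := mul_le_mul_of_nonneg_left h2 hK
        _ = 2 * K * ((q : ℕ) : ℝ) ^ (-(9 / 5 : ℝ)) := by ring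
  obtain ⟨hind_sum, hind_le⟩ := tsum_indicator_small_primes_le Q₀ hK
  have htail_sum : Summable fun q : Nat.Primes => 2 * K * ((q : ℕ) : ℝ) ^ (-(9 / 5 : ℝ)) :=
    (summable_primes_rpow' (by norm_num)).mul_left _
  have hcsum : Summable c := hind_sum.add htail_sum
  have hctsum : ∑' q, c q ≤ K * Q₀ + 2 * K * Z := by
    rw [show c = fun q : Nat.Primes =>
        (if (q : ℕ) < Q₀ then K else 0) + 2 * K * ((q : ℕ) : ℝ) ^ (-(9 / 5 : ℝ)) from rfl,
      hind_sum.tsum_add htail_sum, tsum_mul_left]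
    have h2 : 2 * K * ∑' q : Nat.Primes, ((q : ℕ) : ℝ) ^ (-(9 / 5 : ℝ)) ≤ 2 * K * Z :=
      mul_le_mul_of_nonneg_left (tsum_primes_rpow_le' (by norm_num)) (by positivity)
    linarith
  have h1 : ∏ q ∈ A.filter (fun q : Nat.Primes => ¬ (q : ℕ) ∣ D), ‖F q s‖ ≤
      ∏ q ∈ A.filter (fun q : Nat.Primes => ¬ (q : ℕ) ∣ D), (1 + c q) := by
    refine Finset.prod_le_prod (fun _ _ => norm_nonneg _) fun q hq => ?_
    have hqD : ¬ (q : ℕ) ∣ D := (Finset.mem_filter.mp hq).2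
    have hb := hFc q hqD
    calc ‖F q s‖ ≤ ‖F q s - 1‖ + ‖(1 : ℂ)‖ := by
          have := norm_add_le (F q s - 1) 1; rwa [sub_add_cancel] at this
      _ ≤ c q + 1 := by rw [norm_one]; linarith
      _ = 1 + c q := by ring
  have h2 := prod_one_add_le_exp_sum' (A.filter (fun q : Nat.Primes => ¬ (q : ℕ) ∣ D)) c
    (fun q _ => hc0 q)
  have h3 : ∑ q ∈ A.filter (fun q : Nat.Primes => ¬ (q : ℕ) ∣ D), c q ≤ K * Q₀ + 2 * K * Z :=
    (hcsum.sum_le_tsum _ (fun q _ => hc0 q)).trans hctsum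
  exact h1.trans (h2.trans (Real.exp_le_exp.mpr h3))

/-! ## Holomorphy of the Euler product on `σ > 9/10` -/

/-- **Holomorphy of `∏'_q Φ_q` on `σ > 9/10`** from the majorant-shape data (Weierstrass `M`-test,
`Literature.Analysis.Complex.differentiableOn_tprod_of_norm_sub_one_le`, majorant
`3·[q ∣ D] + K·[q < Q₀] + 2K q^{−9/5}`). [cite: Zhang2022LandauSiegel, App. A p. 105] -/
theorem differentiableOn_tprod_of_majorant {D Q₀ : ℕ} (hD : 0 < D) {K : ℝ} (hK : 0 ≤ K)
    (F : Nat.Primes → ℂ → ℂ)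
    (hdiff : ∀ q : Nat.Primes, DifferentiableOn ℂ (F q) {s : ℂ | 9 / 10 < s.re})
    (hdvd : ∀ q : Nat.Primes, (q : ℕ) ∣ D → ∀ s : ℂ, 9 / 10 < s.re →
      F q s = (1 - ((q : ℕ) : ℂ) ^ (-s)) ^ 2)
    (hcrude : ∀ q : Nat.Primes, ¬ (q : ℕ) ∣ D → ∀ s : ℂ, 9 / 10 < s.re → ‖F q s - 1‖ ≤ K)
    (htail : ∀ q : Nat.Primes, ¬ (q : ℕ) ∣ D → Q₀ ≤ (q : ℕ) → ∀ s : ℂ, 9 / 10 < s.re →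
      ‖F q s - 1‖ ≤ K * (‖((q : ℕ) : ℂ) ^ (-s)‖ / (q : ℕ) + ‖((q : ℕ) : ℂ) ^ (-s)‖ ^ 2)) :
    DifferentiableOn ℂ (fun s => ∏' q : Nat.Primes, F q s) {s : ℂ | 9 / 10 < s.re} := by
  classical
  set O : Set ℂ := {s : ℂ | 9 / 10 < s.re} with hOdef
  have hO : IsOpen O := isOpen_lt continuous_const Complex.continuous_re
  set b : Nat.Primes → ℝ := fun q =>
    (if (q : ℕ) ∣ D then 3 else 0) + ((if (q : ℕ) < Q₀ then K else 0) +
      2 * K * ((q : ℕ) : ℝ) ^ (-(9 / 5 : ℝ))) with hbdef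
  set S₂ : Finset Nat.Primes := D.primeFactors.subtype Nat.Prime with hS₂def
  have hb1sum : Summable fun q : Nat.Primes => (if (q : ℕ) ∣ D then (3 : ℝ) else 0) := by
    refine summable_of_ne_finset_zero (s := S₂) fun q hq' => ?_
    have hndvd : ¬ (q : ℕ) ∣ D := fun h' =>
      hq' (Finset.mem_subtype.mpr (Nat.mem_primeFactors.mpr ⟨q.prop, h', hD.ne'⟩))
    rw [if_neg hndvd]
  obtain ⟨hind_sum, -⟩ := tsum_indicator_small_primes_le Q₀ hK
  have htail_sum : Summable fun q : Nat.Primes => 2 * K * ((q : ℕ) : ℝ) ^ (-(9 / 5 : ℝ)) :=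
    (summable_primes_rpow' (by norm_num)).mul_left _
  have hbsum : Summable b := hb1sum.add (hind_sum.add htail_sum)
  have hFb : ∀ q : Nat.Primes, ∀ s ∈ O, ‖F q s - 1‖ ≤ b q := by
    intro q s hs
    have hs' : 9 / 10 < s.re := hs
    have hnn1 : 0 ≤ (if (q : ℕ) < Q₀ then K else 0) := by split_ifs <;> positivity
    have hnn2 : 0 ≤ 2 * K * ((q : ℕ) : ℝ) ^ (-(9 / 5 : ℝ)) := by positivity
    have hnn3 : 0 ≤ (if (q : ℕ) ∣ D then (3 : ℝ) else 0) := by split_ifs <;> positivity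
    by_cases hqD : (q : ℕ) ∣ D
    · have h3 := norm_one_sub_cpow_sq_sub_one_le' q.prop (s := s) (by linarith)
      rw [hdvd q hqD s hs']
      simp only [hbdef, if_pos hqD]
      linarith
    · simp only [hbdef, if_neg hqD, zero_add]
      by_cases hq : (q : ℕ) < Q₀
      · rw [if_pos hq]
        linarith [hcrude q hqD s hs']
      · rw [if_neg hq, zero_add]
        have h := htail q hqD (not_lt.mp hq) s hs'
        have h2 := tail_shape_le q.prop hs'
        calc ‖F q s - 1‖ ≤ K * (‖((q : ℕ) : ℂ) ^ (-s)‖ / (q : ℕ) + ‖((q : ℕ) : ℂ) ^ (-s)‖ ^ 2) := h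
          _ ≤ K * (2 * ((q : ℕ) : ℝ) ^ (-(9 / 5 : ℝ))) := mul_le_mul_of_nonneg_left h2 hK
          _ = 2 * K * ((q : ℕ) : ℝ) ^ (-(9 / 5 : ℝ)) := by ring
  exact Literature.Analysis.Complex.differentiableOn_tprod_of_norm_sub_one_le hO hdiff hbsum hFb

/-! ## The half-plane bound on `σ > 9/10` -/

/-- **The explicit half-plane bound, majorant shape** (clauses (iii) and (iv) of `Lemma162Rq`): for a
constant `K′ ≥ 1` depending only on `K, Q₀`, every family with `Φ_q = (1 − q^{−s})²` (`q ∣ D`),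
`‖Φ_q − 1‖ ≤ K` (`q ∤ D`) and `‖Φ_q − 1‖ ≤ K(|q^{−s}|/q + |q^{−s}|²)` (`q ≥ Q₀`, `q ∤ D`) on
`σ > 9/10` satisfies `‖∏'_q Φ_q(s)‖ ≤ K′·exp(2𝓛^{1/10})` for every `s` with `σ > 9/10`
(`∏_{q∣D}(1 + q^{−9/10})² ≤ K₀e^{2𝓛^{1/10}}`, `Typed.Section15C.prod_primeFactors_one_add_rpow_sq_le`;
cofactor `≤ exp(KQ₀ + 2Kζ(9/5))`). [cite: Zhang2022LandauSiegel, §16 Lemma 16.2 p.94] -/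
theorem exists_halfPlane_bound_of_majorant {K : ℝ} (hK : 0 ≤ K) (Q₀ : ℕ) :
    ∃ K' : ℝ, 1 ≤ K' ∧ ∀ (D : ℕ), 0 < D → ∀ F : Nat.Primes → ℂ → ℂ,
      (∀ q : Nat.Primes, (q : ℕ) ∣ D → ∀ s : ℂ, 9 / 10 < s.re →
        F q s = (1 - ((q : ℕ) : ℂ) ^ (-s)) ^ 2) →
      (∀ q : Nat.Primes, ¬ (q : ℕ) ∣ D → ∀ s : ℂ, 9 / 10 < s.re → ‖F q s - 1‖ ≤ K) →
      (∀ q : Nat.Primes, ¬ (q : ℕ) ∣ D → Q₀ ≤ (q : ℕ) → ∀ s : ℂ, 9 / 10 < s.re →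
        ‖F q s - 1‖ ≤ K * (‖((q : ℕ) : ℂ) ^ (-s)‖ / (q : ℕ) + ‖((q : ℕ) : ℂ) ^ (-s)‖ ^ 2)) →
      ∀ s : ℂ, 9 / 10 < s.re →
        ‖∏' q : Nat.Primes, F q s‖ ≤ K' * Real.exp (2 * ell D ^ (1 / 10 : ℝ)) := by
  classical
  set Z : ℝ := ∑' n : ℕ, (n : ℝ) ^ (-(9 / 5 : ℝ)) with hZdef
  set CD : ℝ := Real.exp (20 * Real.exp ((10 ^ 10 + 1) / 10)) with hCDdef
  set E : ℝ := Real.exp (K * Q₀ + 2 * K * Z) with hEdef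
  set K' : ℝ := CD * E with hK'def
  have hCD1 : 1 ≤ CD := Real.one_le_exp (by positivity)
  have hZ0 : 0 ≤ Z := tsum_nonneg fun n => Real.rpow_nonneg (Nat.cast_nonneg n) _
  have hE1 : 1 ≤ E := Real.one_le_exp (by positivity)
  have hK'1 : 1 ≤ K' := by
    calc (1 : ℝ) = 1 * 1 := by ring
      _ ≤ CD * E := mul_le_mul hCD1 hE1 zero_le_one (by positivity)
  refine ⟨K', hK'1, fun D hD F hdvd hcrude htail s hs => ?_⟩
  have hCDle : ∏ q ∈ D.primeFactors, (1 + (q : ℝ) ^ (-(9 / 10 : ℝ))) ^ 2 ≤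
      CD * Real.exp (2 * Real.log D ^ (1 / 10 : ℝ)) :=
    Typed.Section15C.prod_primeFactors_one_add_rpow_sq_le D
  have hB1 : 1 ≤ K' * Real.exp (2 * ell D ^ (1 / 10 : ℝ)) := by
    have hℓ : 0 ≤ ell D := by rw [ell]; exact Real.log_natCast_nonneg D
    have h3 : 1 ≤ Real.exp (2 * ell D ^ (1 / 10 : ℝ)) :=
      Real.one_le_exp (by have := Real.rpow_nonneg hℓ (1 / 10 : ℝ); positivity)
    calc (1 : ℝ) = 1 * 1 := by ring
      _ ≤ K' * Real.exp (2 * ell D ^ (1 / 10 : ℝ)) := mul_le_mul hK'1 h3 zero_le_one (by positivity)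
  refine Literature.Analysis.Complex.norm_tprod_le_of_forall_norm_prod_le (fun q => F q s) hB1
    fun A => ?_
  rw [Complex.norm_prod, ← Finset.prod_filter_mul_prod_filter_not A (fun q : Nat.Primes => (q : ℕ) ∣ D)]
  -- the `q ∣ D` part
  have hdvd_part : ∏ q ∈ A.filter (fun q : Nat.Primes => (q : ℕ) ∣ D), ‖F q s‖ ≤
      CD * Real.exp (2 * ell D ^ (1 / 10 : ℝ)) := by
    have h1 : ∏ q ∈ A.filter (fun q : Nat.Primes => (q : ℕ) ∣ D), ‖F q s‖ ≤
        ∏ q ∈ A.filter (fun q : Nat.Primes => (q : ℕ) ∣ D),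
          (1 + ((q : ℕ) : ℝ) ^ (-(9 / 10 : ℝ))) ^ 2 := by
      refine Finset.prod_le_prod (fun _ _ => norm_nonneg _) fun q hq => ?_
      have hqD : (q : ℕ) ∣ D := (Finset.mem_filter.mp hq).2
      rw [hdvd q hqD s hs, norm_pow]
      exact pow_le_pow_left₀ (norm_nonneg _) (norm_one_sub_cpow_le' q.prop hs.le) 2
    set g : ℕ → ℝ := fun n => (1 + (n : ℝ) ^ (-(9 / 10 : ℝ))) ^ 2 with hgdef
    have h2 : ∏ q ∈ A.filter (fun q : Nat.Primes => (q : ℕ) ∣ D),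
        (1 + ((q : ℕ) : ℝ) ^ (-(9 / 10 : ℝ))) ^ 2 =
        ∏ n ∈ (A.filter (fun q : Nat.Primes => (q : ℕ) ∣ D)).map
          (Function.Embedding.subtype _), g n := by
      rw [Finset.prod_map]
      rfl
    have hsubset : (A.filter (fun q : Nat.Primes => (q : ℕ) ∣ D)).map
        (Function.Embedding.subtype _) ⊆ D.primeFactors := by
      intro n hn
      obtain ⟨q, hq, rfl⟩ := Finset.mem_map.mp hn
      have hqD : (q : ℕ) ∣ D := (Finset.mem_filter.mp hq).2
      exact Nat.mem_primeFactors.mpr ⟨q.prop, hqD, hD.ne'⟩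
    have h3 : ∏ n ∈ (A.filter (fun q : Nat.Primes => (q : ℕ) ∣ D)).map
          (Function.Embedding.subtype _), g n ≤ ∏ n ∈ D.primeFactors, g n :=
      prod_le_prod_of_subset_real' g hsubset (fun n _ => by positivity) (fun n _ _ => by
        simp only [hgdef]
        have : 0 ≤ (n : ℝ) ^ (-(9 / 10 : ℝ)) := Real.rpow_nonneg (Nat.cast_nonneg n) _
        nlinarith)
    calc ∏ q ∈ A.filter (fun q : Nat.Primes => (q : ℕ) ∣ D), ‖F q s‖
        ≤ ∏ n ∈ D.primeFactors, g n := h1.trans (h2 ▸ h3)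
      _ ≤ CD * Real.exp (2 * Real.log D ^ (1 / 10 : ℝ)) := hCDle
      _ = CD * Real.exp (2 * ell D ^ (1 / 10 : ℝ)) := by rw [ell]
  -- the `q ∤ D` part
  have hcop_part : ∏ q ∈ A.filter (fun q : Nat.Primes => ¬ (q : ℕ) ∣ D), ‖F q s‖ ≤ E :=
    prod_filter_not_dvd_le hK F hs (fun q hqD => hcrude q hqD s hs)
      (fun q hqD hq => htail q hqD hq s hs) A
  have hnn1 : 0 ≤ ∏ q ∈ A.filter (fun q : Nat.Primes => ¬ (q : ℕ) ∣ D), ‖F q s‖ :=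
    Finset.prod_nonneg fun _ _ => norm_nonneg _
  calc (∏ q ∈ A.filter (fun q : Nat.Primes => (q : ℕ) ∣ D), ‖F q s‖) *
        ∏ q ∈ A.filter (fun q : Nat.Primes => ¬ (q : ℕ) ∣ D), ‖F q s‖
      ≤ (CD * Real.exp (2 * ell D ^ (1 / 10 : ℝ))) * E :=
        mul_le_mul hdvd_part hcop_part hnn1 (by positivity)
    _ = K' * Real.exp (2 * ell D ^ (1 / 10 : ℝ)) := by rw [hK'def]; ring

/-! ## The near-`1` bound on `‖s − 1‖ ≤ 1/𝓛` -/

/-- **The near-`1` bound, majorant shape** (clause (v) of `Lemma162Rq`): for a constant `K′ ≥ 1`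
depending only on `K, Q₀`, for `D ≥ 3` with `D/φ(D) ≤ 2 log 𝓛`, `(2 log 𝓛)⁶ ≤ 𝓛`, `𝓛 ≥ 20`, every
family as in `exists_halfPlane_bound_of_majorant` has `‖∏'_q Φ_q(s)‖ ≤ K′·𝓛` whenever
`‖s − 1‖ ≤ 1/𝓛` (the disc lies in `σ ≥ 19/20`; `‖(1 − q^{−s})²‖ ≤ (1 + 3/q)²` for `q ≤ D`,
`Typed.Section15C.norm_one_sub_cpow_sq_le_near_one`; `∏_{q∣D}(1 + 3/q)² ≤ (D/φ(D))⁶ ≤ 𝓛`).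
[cite: Zhang2022LandauSiegel, §16 Lemma 16.2 p.94] -/
theorem exists_nearOne_bound_of_majorant {K : ℝ} (hK : 0 ≤ K) (Q₀ : ℕ) :
    ∃ K' : ℝ, 1 ≤ K' ∧ ∀ (D : ℕ), 3 ≤ D → (D : ℝ) / Nat.totient D ≤ 2 * Real.log (ell D) →
      (2 * Real.log (ell D)) ^ 6 ≤ ell D → 20 ≤ ell D → ∀ F : Nat.Primes → ℂ → ℂ,
      (∀ q : Nat.Primes, (q : ℕ) ∣ D → ∀ s : ℂ, 9 / 10 < s.re →
        F q s = (1 - ((q : ℕ) : ℂ) ^ (-s)) ^ 2) →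
      (∀ q : Nat.Primes, ¬ (q : ℕ) ∣ D → ∀ s : ℂ, 9 / 10 < s.re → ‖F q s - 1‖ ≤ K) →
      (∀ q : Nat.Primes, ¬ (q : ℕ) ∣ D → Q₀ ≤ (q : ℕ) → ∀ s : ℂ, 9 / 10 < s.re →
        ‖F q s - 1‖ ≤ K * (‖((q : ℕ) : ℂ) ^ (-s)‖ / (q : ℕ) + ‖((q : ℕ) : ℂ) ^ (-s)‖ ^ 2)) →
      ∀ s : ℂ, ‖s - 1‖ ≤ 1 / ell D → ‖∏' q : Nat.Primes, F q s‖ ≤ K' * ell D := by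
  classical
  set Z : ℝ := ∑' n : ℕ, (n : ℝ) ^ (-(9 / 5 : ℝ)) with hZdef
  have hZ0 : 0 ≤ Z := tsum_nonneg fun n => Real.rpow_nonneg (Nat.cast_nonneg n) _
  set K' : ℝ := Real.exp (K * Q₀ + 2 * K * Z) with hK'def
  have hK'1 : 1 ≤ K' := Real.one_le_exp (by positivity)
  refine ⟨K', hK'1, fun D hD3 hφ hpow6 hℓ20 F hdvd hcrude htail s hs => ?_⟩
  have hDpos : 0 < D := by omega
  have hℓ0 : 0 < ell D := by linarith
  have hσ : 1 - 1 / ell D ≤ s.re := by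
    have h1 : |(s - 1).re| ≤ ‖s - 1‖ := Complex.abs_re_le_norm _
    rw [Complex.sub_re, Complex.one_re] at h1
    have := (abs_le.mp (h1.trans hs)).1
    linarith
  have hinv : 1 / ell D ≤ 1 / 20 := one_div_le_one_div_of_le (by norm_num) hℓ20
  have hsO : 9 / 10 < s.re := by linarith
  have hφ1 : (1 : ℝ) ≤ (D : ℝ) / Nat.totient D := by
    rw [le_div_iff₀ (by exact_mod_cast Nat.totient_pos.mpr hDpos)]
    simpa using (show (Nat.totient D : ℝ) ≤ D by exact_mod_cast Nat.totient_le D)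
  have hB1 : 1 ≤ K' * ((D : ℝ) / Nat.totient D) ^ 6 := by
    calc (1 : ℝ) = 1 * 1 := (mul_one _).symm
      _ ≤ K' * ((D : ℝ) / Nat.totient D) ^ 6 :=
          mul_le_mul hK'1 (one_le_pow₀ hφ1) zero_le_one (by positivity)
  have hUB : ‖∏' q : Nat.Primes, F q s‖ ≤ K' * ((D : ℝ) / Nat.totient D) ^ 6 := by
    refine Literature.Analysis.Complex.norm_tprod_le_of_forall_norm_prod_le (fun q => F q s) hB1
      fun A => ?_
    rw [Complex.norm_prod,
      ← Finset.prod_filter_mul_prod_filter_not A (fun q : Nat.Primes => (q : ℕ) ∣ D)]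
    -- the `q ∣ D` part: `≤ ∏_{q∣D}(1 + 3/q)² ≤ (D/φ(D))⁶`
    have hdvd_part : ∏ q ∈ A.filter (fun q : Nat.Primes => (q : ℕ) ∣ D), ‖F q s‖ ≤
        ((D : ℝ) / Nat.totient D) ^ 6 := by
      have h1 : ∏ q ∈ A.filter (fun q : Nat.Primes => (q : ℕ) ∣ D), ‖F q s‖ ≤
          ∏ q ∈ A.filter (fun q : Nat.Primes => (q : ℕ) ∣ D), (1 + 3 / ((q : ℕ) : ℝ)) ^ 2 := by
        refine Finset.prod_le_prod (fun _ _ => norm_nonneg _) fun q hq => ?_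
        have hqD : (q : ℕ) ∣ D := (Finset.mem_filter.mp hq).2
        rw [hdvd q hqD s hsO]
        exact Typed.Section15C.norm_one_sub_cpow_sq_le_near_one hD3 q.prop (Nat.le_of_dvd hDpos hqD)
          (by rw [ell] at hs; exact hs)
      set g : ℕ → ℝ := fun n => (1 + 3 / (n : ℝ)) ^ 2 with hgdef
      have h2 : ∏ q ∈ A.filter (fun q : Nat.Primes => (q : ℕ) ∣ D), (1 + 3 / ((q : ℕ) : ℝ)) ^ 2 =
          ∏ n ∈ (A.filter (fun q : Nat.Primes => (q : ℕ) ∣ D)).map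
            (Function.Embedding.subtype _), g n := by
        rw [Finset.prod_map]
        rfl
      have hsubset : (A.filter (fun q : Nat.Primes => (q : ℕ) ∣ D)).map
          (Function.Embedding.subtype _) ⊆ D.primeFactors := by
        intro n hn
        obtain ⟨q, hq, rfl⟩ := Finset.mem_map.mp hn
        have hqD : (q : ℕ) ∣ D := (Finset.mem_filter.mp hq).2
        exact Nat.mem_primeFactors.mpr ⟨q.prop, hqD, hDpos.ne'⟩
      have h3 : ∏ n ∈ (A.filter (fun q : Nat.Primes => (q : ℕ) ∣ D)).map
            (Function.Embedding.subtype _), g n ≤ ∏ n ∈ D.primeFactors, g n :=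
        prod_le_prod_of_subset_real' g hsubset (fun n _ => by positivity) (fun n _ _ => by
          simp only [hgdef]
          have : 0 ≤ 3 / (n : ℝ) := by positivity
          nlinarith)
      have h4 : ∏ n ∈ D.primeFactors, g n ≤ ((D : ℝ) / Nat.totient D) ^ 6 := by
        have h5 := prod_primeFactors_one_add_div_le_pow'' hDpos.ne' 3
        have h6 : ∏ n ∈ D.primeFactors, g n =
            (∏ n ∈ D.primeFactors, (1 + ((3 : ℕ) : ℝ) / n)) ^ 2 := by
          rw [← Finset.prod_pow]
          refine Finset.prod_congr rfl fun n _ => ?_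
          simp only [hgdef]; push_cast; ring
        rw [h6]
        calc (∏ n ∈ D.primeFactors, (1 + ((3 : ℕ) : ℝ) / n)) ^ 2
            ≤ (((D : ℝ) / Nat.totient D) ^ 3) ^ 2 :=
              pow_le_pow_left₀ (Finset.prod_nonneg fun n _ => by positivity) h5 2
          _ = ((D : ℝ) / Nat.totient D) ^ 6 := by ring
      calc ∏ q ∈ A.filter (fun q : Nat.Primes => (q : ℕ) ∣ D), ‖F q s‖
          ≤ ∏ n ∈ D.primeFactors, g n := h1.trans (h2 ▸ h3)
        _ ≤ ((D : ℝ) / Nat.totient D) ^ 6 := h4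
    -- the `q ∤ D` part
    have hcop_part : ∏ q ∈ A.filter (fun q : Nat.Primes => ¬ (q : ℕ) ∣ D), ‖F q s‖ ≤ K' :=
      prod_filter_not_dvd_le hK F hsO (fun q hqD => hcrude q hqD s hsO)
        (fun q hqD hq => htail q hqD hq s hsO) A
    have hnn1 : 0 ≤ ∏ q ∈ A.filter (fun q : Nat.Primes => ¬ (q : ℕ) ∣ D), ‖F q s‖ :=
      Finset.prod_nonneg fun _ _ => norm_nonneg _
    calc (∏ q ∈ A.filter (fun q : Nat.Primes => (q : ℕ) ∣ D), ‖F q s‖) *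
          ∏ q ∈ A.filter (fun q : Nat.Primes => ¬ (q : ℕ) ∣ D), ‖F q s‖
        ≤ ((D : ℝ) / Nat.totient D) ^ 6 * K' :=
          mul_le_mul hdvd_part hcop_part hnn1 (by positivity)
      _ = K' * ((D : ℝ) / Nat.totient D) ^ 6 := by ring
  have h6 : ((D : ℝ) / Nat.totient D) ^ 6 ≤ ell D :=
    (pow_le_pow_left₀ (le_trans zero_le_one hφ1) hφ 6).trans hpow6
  exact hUB.trans (mul_le_mul_of_nonneg_left h6 (le_trans zero_le_one hK'1))

/-! ## The glue: `Lemma162Rq` from the majorant-shape local inputs -/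

open scoped Classical in
/-- **Lemma 16.2 at the repaired normaliser, explicit bound, near-one clause and value
(`Lemma162Rq c′`) — from the local Euler factors in the majorant shape** (§16 Lemma 16.2 p. 94;
App. A pp. 105–106). HYPOTHESES for a family `Φ χ j q s`: (M) `hmaj`: for some `Q₀, K` and all
large `D`, under (A), for `j = 1, 2` and every prime `q`: `Φ_q` holomorphic on `σ > 9/10`; for
`q ∤ D`, `‖Φ_q(s) − 1‖ ≤ K` there; for `q ≥ Q₀`, `q ∤ D`, `‖Φ_q(s) − 1‖ ≤ K(|q^{−s}|/q + |q^{−s}|²)`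
there; (D) `hdvd`: for `q ∣ D`, `Φ_q(s) = (1 − q^{−s})²` on `σ > 9/10`; (E) `hEuler`: on `σ > 1`,
`∏_q Φ_q(s)` converges to `frakU2SeriesR c′ χ j s`; (V) `hval`: for `q ∤ D`, `q ≤ D`,
`‖Φ_q(1) − m_q‖ ≤ C·α·log q/q`, `m_q` the factor of `hasProd_frakU2Main`. CONCLUSION: `Lemma162Rq c′`
with `U := ∏'_q Φ_q`: (i) `differentiableOn_tprod_of_majorant`; (ii) `HasProd.tprod_eq`; (iii)/(iv)
`exists_halfPlane_bound_of_majorant` (on all of `σ > 9/10`); (v) `exists_nearOne_bound_of_majorant`;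
(vi) `exists_value_bound_of_local` with `C_b := K(Q₀² + 1)` (at `s = 1` the crude bound at
`q < Q₀` is `≤ KQ₀²·q⁻²`), `α𝓛 = π𝓛⁻⁸ ≤ π𝓛⁻⁴`. [cite: Zhang2022LandauSiegel, §16 Lemma 16.2 p.94] -/
theorem lemma162Rq_of_majorant (c' : ℝ)
    (Φ : ∀ {D : ℕ} [NeZero D], DirichletCharacter ℂ D → ℕ → ℕ → ℂ → ℂ)
    (hmaj : ∃ Q₀ : ℕ, ∃ K : ℝ, ForAllLarge fun D _ χ => AssumptionA D χ → ∀ j ∈ ({1, 2} : Finset ℕ),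
      ∀ q : ℕ, q.Prime →
        DifferentiableOn ℂ (fun s => Φ χ j q s) {s : ℂ | 9 / 10 < s.re} ∧
          (¬ q ∣ D → ∀ s : ℂ, 9 / 10 < s.re → ‖Φ χ j q s - 1‖ ≤ K) ∧
          (Q₀ ≤ q → ¬ q ∣ D → ∀ s : ℂ, 9 / 10 < s.re →
            ‖Φ χ j q s - 1‖ ≤ K * (‖(q : ℂ) ^ (-s)‖ / q + ‖(q : ℂ) ^ (-s)‖ ^ 2)))
    (hdvd : ForAllLarge fun D _ χ => AssumptionA D χ → ∀ j ∈ ({1, 2} : Finset ℕ),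
      ∀ q : ℕ, q.Prime → q ∣ D → ∀ s : ℂ, 9 / 10 < s.re →
        Φ χ j q s = (1 - (q : ℂ) ^ (-s)) ^ 2)
    (hEuler : ForAllLarge fun D _ χ => AssumptionA D χ → ∀ j ∈ ({1, 2} : Finset ℕ),
      ∀ s : ℂ, 1 < s.re → HasProd (fun q : Nat.Primes => Φ χ j q s) (frakU2SeriesR c' χ j s))
    (hval : ∃ C : ℝ, ForAllLarge fun D _ χ => AssumptionA D χ → ∀ j ∈ ({1, 2} : Finset ℕ),
      ∀ q : ℕ, q.Prime → ¬ q ∣ D → (q : ℝ) ≤ D →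
        ‖Φ χ j q 1 - (if q = 2 ∧ χ (2 : ZMod D) = 1 then (3 / 8 : ℂ)
            else (1 - (((q : ℂ)) ^ 2)⁻¹) / frakpFactor χ q)‖ ≤
          C * (alpha D * Real.log q / q)) :
    Lemma162Rq c' := by
  obtain ⟨Q₀, K, hmaj⟩ := hmaj
  obtain ⟨Cv, hval⟩ := hval
  -- constants
  set K' : ℝ := max K 0 with hK'def
  set Cv' : ℝ := max Cv 0 with hCv'def
  have hK'0 : 0 ≤ K' := le_max_right _ _
  have hCv'0 : 0 ≤ Cv' := le_max_right _ _
  set Cb : ℝ := K' * ((Q₀ : ℝ) ^ 2 + 1) with hCbdef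
  have hCb0 : 0 ≤ Cb := by positivity
  obtain ⟨KA, hKA1, hKA⟩ := exists_halfPlane_bound_of_majorant hK'0 Q₀
  obtain ⟨KB, hKB1, hKB⟩ := exists_nearOne_bound_of_majorant hK'0 Q₀
  obtain ⟨KC, hKC0, hKC⟩ := exists_value_bound_of_local hCb0 hCv'0
  set Cfin : ℝ := KA + KB + KC * π with hCfindef
  have hKA0 : 0 ≤ KA := le_trans zero_le_one hKA1
  have hKB0 : 0 ≤ KB := le_trans zero_le_one hKB1
  have hKCπ : 0 ≤ KC * π := mul_nonneg hKC0 Real.pi_pos.le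
  have hKA_le : KA ≤ Cfin := by rw [hCfindef]; linarith
  have hKB_le : KB ≤ Cfin := by rw [hCfindef]; linarith
  have hKC_le : KC * π ≤ Cfin := by rw [hCfindef]; linarith
  -- thresholds
  obtain ⟨D₁, hD₁⟩ := Ded1524.self_div_totient_le_two_mul_loglog
  obtain ⟨N, hN⟩ := eventually_loglog_pow_six_le'
  set L₀ : ℝ := max 2 ((Nat.factorial 9 : ℝ) / (1 / 2 : ℝ) ^ 9) with hL₀def
  have hT : ForAllLarge fun D _ _ =>
      ((D : ℝ) / Nat.totient D ≤ 2 * Real.log (ell D)) ∧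
        ((2 * Real.log (ell D)) ^ 6 ≤ ell D ∧ 20 ≤ ell D) ∧ ⌈Real.exp L₀⌉₊ ≤ D ∧ Q₀ ≤ D :=
    ForAllLarge.of_le (max (max (max D₁ N) ⌈Real.exp L₀⌉₊) Q₀) fun D _ _ hD _ _ =>
      ⟨hD₁ D (le_trans (le_trans (le_trans (le_max_left _ _) (le_max_left _ _)) (le_max_left _ _)) hD),
        hN D (le_trans (le_trans (le_trans (le_max_right _ _) (le_max_left _ _)) (le_max_left _ _)) hD),
        le_trans (le_trans (le_max_right _ _) (le_max_left _ _)) hD,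
        le_trans (le_max_right _ _) hD⟩
  refine ⟨Cfin, ((((hmaj.and hdvd).and hEuler).and hval).and hT).mono
    fun D _ χ hq _ hS hA j hj => ?_⟩
  obtain ⟨⟨⟨⟨hmajD, hdvdD⟩, hEulerD⟩, hvalD⟩, ⟨hφ, ⟨hpow6, hℓ20⟩, hDL, hQ₀D⟩⟩ := hS
  have hDpos : 0 < D := Nat.pos_of_ne_zero (NeZero.ne D)
  have hD0 : (0 : ℝ) < D := by exact_mod_cast hDpos
  have hℓL₀ : L₀ ≤ ell D := ell_ge_of_ge_ceil_exp' hDL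
  have hℓ2 : 2 ≤ ell D := le_trans (le_max_left _ _) hℓL₀
  have hℓfac : (Nat.factorial 9 : ℝ) / (1 / 2 : ℝ) ^ 9 ≤ ell D := le_trans (le_max_right _ _) hℓL₀
  have hℓ1 : 1 ≤ ell D := by linarith
  have hℓ0 : 0 < ell D := by linarith
  have hD3 : 3 ≤ D := by
    by_contra hlt
    have : (D : ℝ) < 3 := by exact_mod_cast not_le.mp hlt
    have : ell D < 3 := by
      calc ell D = Real.log D := rfl
        _ < Real.log (Real.exp 3) := Real.log_lt_log hD0 (by
            have := Real.add_one_le_exp (3:ℝ); linarith)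
        _ = 3 := Real.log_exp 3
    linarith
  have hα0 : 0 < alpha D := by
    rw [alpha, bigP, Real.log_exp]; positivity
  -- the factors at this `D, χ, j`
  set F : Nat.Primes → ℂ → ℂ := fun q s => Φ χ j (q : ℕ) s with hFdef
  have hFdiff : ∀ q : Nat.Primes, DifferentiableOn ℂ (F q) {s : ℂ | 9 / 10 < s.re} :=
    fun q => (hmajD hA j hj q q.prop).1
  have hFdvd : ∀ q : Nat.Primes, (q : ℕ) ∣ D → ∀ s : ℂ, 9 / 10 < s.re →
      F q s = (1 - ((q : ℕ) : ℂ) ^ (-s)) ^ 2 :=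
    fun q hqD s hs => hdvdD hA j hj q q.prop hqD s hs
  have hFcrude : ∀ q : Nat.Primes, ¬ (q : ℕ) ∣ D → ∀ s : ℂ, 9 / 10 < s.re → ‖F q s - 1‖ ≤ K' :=
    fun q hqD s hs => ((hmajD hA j hj q q.prop).2.1 hqD s hs).trans (le_max_left _ _)
  have hFtail : ∀ q : Nat.Primes, ¬ (q : ℕ) ∣ D → Q₀ ≤ (q : ℕ) → ∀ s : ℂ, 9 / 10 < s.re →
      ‖F q s - 1‖ ≤ K' * (‖((q : ℕ) : ℂ) ^ (-s)‖ / (q : ℕ) + ‖((q : ℕ) : ℂ) ^ (-s)‖ ^ 2) := by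
    intro q hqD hq s hs
    have h := (hmajD hA j hj q q.prop).2.2 hq hqD s hs
    exact h.trans (mul_le_mul_of_nonneg_right (le_max_left _ _) (by positivity))
  -- the continuation
  set U : ℂ → ℂ := fun s => ∏' q : Nat.Primes, F q s with hUdef
  have hUdiff : DifferentiableOn ℂ U {s : ℂ | 9 / 10 < s.re} :=
    differentiableOn_tprod_of_majorant hDpos hK'0 F hFdiff hFdvd hFcrude hFtail
  have hbound : ∀ s : ℂ, 9 / 10 < s.re → ‖U s‖ ≤ KA * Real.exp (2 * ell D ^ (1 / 10 : ℝ)) :=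
    fun s hs => hKA D hDpos F hFdvd hFcrude hFtail s hs
  have hexp0 : 0 ≤ Real.exp (2 * ell D ^ (1 / 10 : ℝ)) := (Real.exp_pos _).le
  refine ⟨U, hUdiff, ?_, ?_, ?_, ?_, ?_⟩
  · -- (ii) agreement with `frakU2SeriesR` on `σ > 1`
    intro s hs
    exact (hEulerD hA j hj s hs).tprod_eq
  · -- (iii) bounded on `σ > 9/10`
    exact ⟨KA * Real.exp (2 * ell D ^ (1 / 10 : ℝ)), fun s hs => hbound s hs⟩
  · -- (iv) the explicit bound on `Re s ≥ 19/20`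
    intro s hs
    calc ‖U s‖ ≤ KA * Real.exp (2 * ell D ^ (1 / 10 : ℝ)) := hbound s (by linarith)
      _ ≤ Cfin * Real.exp (2 * ell D ^ (1 / 10 : ℝ)) := mul_le_mul_of_nonneg_right hKA_le hexp0
  · -- (v) the near-one bound
    intro s hs
    calc ‖U s‖ ≤ KB * ell D := hKB D hD3 hφ hpow6 hℓ20 F hFdvd hFcrude hFtail s hs
      _ ≤ Cfin * ell D := mul_le_mul_of_nonneg_right hKB_le hℓ0.le
  · -- (vi) the value at `1`
    have h1 : (9 : ℝ) / 10 < (1 : ℂ).re := by norm_num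
    have hFdvd1 : ∀ q : Nat.Primes, (q : ℕ) ∣ D → F q 1 = (1 - (((q : ℕ) : ℂ))⁻¹) ^ 2 := by
      intro q hqD
      rw [hFdvd q hqD 1 h1, Complex.cpow_neg_one]
    have hFcop1 : ∀ q : Nat.Primes, ¬ (q : ℕ) ∣ D →
        ‖F q 1 - 1‖ ≤ 2 * Cb * ((q : ℕ) : ℝ) ^ (-(2 : ℝ)) := by
      intro q hqD
      have hqp : (q : ℕ).Prime := q.prop
      have hq0 : (0 : ℝ) < ((q : ℕ) : ℝ) := by exact_mod_cast hqp.pos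
      have hq1 : (1 : ℝ) ≤ ((q : ℕ) : ℝ) := by exact_mod_cast hqp.one_lt.le
      have hrpow : ((q : ℕ) : ℝ) ^ (-(2 : ℝ)) = (((q : ℕ) : ℝ) ^ 2)⁻¹ := by
        rw [Real.rpow_neg hq0.le, ← Real.rpow_natCast _ 2]; norm_num
      by_cases hq : Q₀ ≤ (q : ℕ)
      · -- the true size at `s = 1`: `K'(q⁻¹/q + q⁻²) = 2K'q⁻²`
        have h := hFtail q hqD hq 1 h1
        have hn : ‖((q : ℕ) : ℂ) ^ (-(1 : ℂ))‖ = (((q : ℕ) : ℝ))⁻¹ := by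
          rw [Complex.cpow_neg_one, norm_inv, Complex.norm_natCast]
        rw [hn] at h
        have e : (((q : ℕ) : ℝ))⁻¹ / (q : ℕ) + ((((q : ℕ) : ℝ))⁻¹) ^ 2 =
            2 * ((q : ℕ) : ℝ) ^ (-(2 : ℝ)) := by
          rw [hrpow]; field_simp; ring
        rw [e] at h
        have hnn : 0 ≤ 2 * ((q : ℕ) : ℝ) ^ (-(2 : ℝ)) := by positivity
        calc ‖F q 1 - 1‖ ≤ K' * (2 * ((q : ℕ) : ℝ) ^ (-(2 : ℝ))) := h
          _ ≤ Cb * (2 * ((q : ℕ) : ℝ) ^ (-(2 : ℝ))) := by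
              refine mul_le_mul_of_nonneg_right ?_ hnn
              rw [hCbdef]
              have : (1 : ℝ) ≤ (Q₀ : ℝ) ^ 2 + 1 := by nlinarith
              nlinarith
          _ = 2 * Cb * ((q : ℕ) : ℝ) ^ (-(2 : ℝ)) := by ring
      · -- the crude size at `q < Q₀`: `K' ≤ K'Q₀²·q⁻²`
        have hqlt : ((q : ℕ) : ℝ) < Q₀ := by exact_mod_cast not_le.mp hq
        have h := hFcrude q hqD 1 h1
        have hq2 : ((q : ℕ) : ℝ) ^ 2 ≤ (Q₀ : ℝ) ^ 2 := by
          nlinarith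
        have hkey : K' ≤ 2 * Cb * ((q : ℕ) : ℝ) ^ (-(2 : ℝ)) := by
          rw [hrpow, hCbdef]
          rw [show 2 * (K' * ((Q₀ : ℝ) ^ 2 + 1)) * (((q : ℕ) : ℝ) ^ 2)⁻¹ =
              K' * (2 * ((Q₀ : ℝ) ^ 2 + 1) / ((q : ℕ) : ℝ) ^ 2) by ring]
          have hq2pos : 0 < ((q : ℕ) : ℝ) ^ 2 := by positivity
          have hfrac : 1 ≤ 2 * ((Q₀ : ℝ) ^ 2 + 1) / ((q : ℕ) : ℝ) ^ 2 := by
            rw [le_div_iff₀ hq2pos]; nlinarith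
          calc K' = K' * 1 := (mul_one _).symm
            _ ≤ K' * (2 * ((Q₀ : ℝ) ^ 2 + 1) / ((q : ℕ) : ℝ) ^ 2) :=
                mul_le_mul_of_nonneg_left hfrac hK'0
        exact h.trans hkey
    have hFval1 : ∀ q : Nat.Primes, ¬ (q : ℕ) ∣ D → ((q : ℕ) : ℝ) ≤ D →
        ‖F q 1 - (if (q : ℕ) = 2 ∧ χ (2 : ZMod D) = 1 then (3 / 8 : ℂ)
            else (1 - ((((q : ℕ) : ℂ)) ^ 2)⁻¹) / frakpFactor χ q)‖ ≤
          Cv' * (alpha D * Real.log (q : ℕ) / (q : ℕ)) := by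
      intro q hqD hqle
      have hqp : (q : ℕ).Prime := q.prop
      have hq0 : (0 : ℝ) < ((q : ℕ) : ℝ) := by exact_mod_cast hqp.pos
      have h := hvalD hA j hj q hqp hqD hqle
      exact h.trans (mul_le_mul_of_nonneg_right (le_max_left _ _)
        (div_nonneg (mul_nonneg hα0.le (Real.log_natCast_nonneg _)) hq0.le))
    have hv := hKC D χ hq hℓ2 hℓfac (fun q => F q 1) hFdvd1 hFcop1 hFval1
    calc ‖U 1 - frakU2Main χ‖ ≤ KC * (alpha D * ell D) := hv
      _ ≤ KC * (π * (ell D ^ 4)⁻¹) := mul_le_mul_of_nonneg_left (alpha_mul_ell_le' hℓ1) hKC0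
      _ = (KC * π) * (ell D ^ 4)⁻¹ := by ring
      _ ≤ Cfin * (ell D ^ 4)⁻¹ := mul_le_mul_of_nonneg_right hKC_le (by positivity)

open scoped Classical in
/-- **`Lemma162Rp` and `Lemma162R` from the same majorant-shape inputs** (projections
`lemma162Rp_of_Rq`, `lemma162R_of_Rq`). [cite: Zhang2022LandauSiegel, §16 Lemma 16.2 p.94] -/
theorem lemma162R_of_majorant (c' : ℝ)
    (Φ : ∀ {D : ℕ} [NeZero D], DirichletCharacter ℂ D → ℕ → ℕ → ℂ → ℂ)
    (hmaj : ∃ Q₀ : ℕ, ∃ K : ℝ, ForAllLarge fun D _ χ => AssumptionA D χ → ∀ j ∈ ({1, 2} : Finset ℕ),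
      ∀ q : ℕ, q.Prime →
        DifferentiableOn ℂ (fun s => Φ χ j q s) {s : ℂ | 9 / 10 < s.re} ∧
          (¬ q ∣ D → ∀ s : ℂ, 9 / 10 < s.re → ‖Φ χ j q s - 1‖ ≤ K) ∧
          (Q₀ ≤ q → ¬ q ∣ D → ∀ s : ℂ, 9 / 10 < s.re →
            ‖Φ χ j q s - 1‖ ≤ K * (‖(q : ℂ) ^ (-s)‖ / q + ‖(q : ℂ) ^ (-s)‖ ^ 2)))
    (hdvd : ForAllLarge fun D _ χ => AssumptionA D χ → ∀ j ∈ ({1, 2} : Finset ℕ),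
      ∀ q : ℕ, q.Prime → q ∣ D → ∀ s : ℂ, 9 / 10 < s.re →
        Φ χ j q s = (1 - (q : ℂ) ^ (-s)) ^ 2)
    (hEuler : ForAllLarge fun D _ χ => AssumptionA D χ → ∀ j ∈ ({1, 2} : Finset ℕ),
      ∀ s : ℂ, 1 < s.re → HasProd (fun q : Nat.Primes => Φ χ j q s) (frakU2SeriesR c' χ j s))
    (hval : ∃ C : ℝ, ForAllLarge fun D _ χ => AssumptionA D χ → ∀ j ∈ ({1, 2} : Finset ℕ),
      ∀ q : ℕ, q.Prime → ¬ q ∣ D → (q : ℝ) ≤ D →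
        ‖Φ χ j q 1 - (if q = 2 ∧ χ (2 : ZMod D) = 1 then (3 / 8 : ℂ)
            else (1 - (((q : ℂ)) ^ 2)⁻¹) / frakpFactor χ q)‖ ≤
          C * (alpha D * Real.log q / q)) :
    Lemma162Rp c' ∧ Lemma162R c' :=
  ⟨lemma162Rp_of_Rq c' (lemma162Rq_of_majorant c' Φ hmaj hdvd hEuler hval),
    lemma162R_of_Rq c' (lemma162Rq_of_majorant c' Φ hmaj hdvd hEuler hval)⟩

end Literature.NumberTheory.LFunctions.Zhang2022.Typed.Section16B

end
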